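import Mathlib.Analysis.Distribution.SchwartzSpace.Basic
import Mathlib.Analysis.Fourier.FourierTransform
import Mathlib.Analysis.InnerProductSpace.PiL2
import Literature.NumberTheory.LFunctions.ZeroStatistics
import HarnessLib

/-!
# The Alternative Hypothesis for the zeros of `ζ`: predicates, Baluyot–Goldston–Suriajaya–
# Turnage-Butterbaugh 2025 (Theorems 1–2, Corollaries 1–3, MT-Pairs) and Lagarias–Rodgers 2020
# (Conjecture 2.2, Theorem 3.1)

Topic `Literature/NumberTheory/LFunctions` (namespace `Literature.NumberTheory.LFunctions`; the
pair-counting objects of Baluyot 2016 / BGSTB 2025 live in the sub-namespace `AH`, the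
Lagarias–Rodgers correlation functionals in `LagariasRodgers2020`). STATEMENT LAYER, cell
`rh-crit/ah` (C5, typer t5). LABEL: **NOT RH-BEARING** — every theorem below is a CONDITIONAL with
its hypotheses explicit (`RiemannHypothesis → AHPairs → …`); the Alternative Hypothesis and its
variants (AH, AH-Pairs, Strong AH-Pairs, AH-Density, ESH) are plain PREDICATES, consumed as
hypotheses and never asserted; nothing here bears on the truth of RH or of AH.

## What the sources print (held texts, read 2026-08-26)

**[BGSTB25]** S. A. C. Baluyot, D. A. Goldston, A. I. Suriajaya, C. L. Turnage-Butterbaugh, *The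
Alternative Hypothesis for zeros of the Riemann zeta-function*, arXiv:2508.10857 (2025), §§1–2
(held TeX text `paper:arxiv-2508.10857`, chunks p0003–p0008; UNREFEREED, D-0012 claims):

* §1 (p0003:L17–L32): `γ̃ := (γ/2π) log γ`; **(AH)** (Baluyot 2016): "For each integer `n ≥ 1`
  there exists an integer `k_n ≥ 0` with `γ̃_{n+1} − γ̃_n = ½ k_n + O(|γ_{n+1} − γ_n| · ψ(γ_n))`,
  where `ψ(γ)` is a positive function such that `ψ(γ) → ∞` and `ψ(γ) = o(log γ)` as `γ → ∞`."
* §1 (p0003:L36–L44): **(AH-Pairs)** "Suppose `M` is a positive real number that we can take as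
  large as we wish, and let `R(T)` be a positive decreasing function such that `R(T) → 0` as
  `T → ∞`. Define `𝒫(T, M) := {(γ, γ') : T/log²T < γ, γ' ≤ T, |((γ − γ')/2π) log T| ≤ M}`. Then
  for every `(γ, γ') ∈ 𝒫(T, M)` there is an integer `k` such that
  `(γ − γ') (log T)/2π = k/2 + O((|k| + 1) R(T))`." (Remark 1: the pair `γ = γ'` occurs `m_γ²` times
  for a zero of multiplicity `m_γ` — pairs are counted with multiplicity.)
* §1 (p0003:L55–L61): for fixed `0 < δ ≤ 1/2`,
  `B_{k/2} = B_{k/2}(T, M, δ) := {(γ, γ') ∈ 𝒫(T, M) : k/2 − δ/2 < ((γ − γ')/2π) log T ≤ k/2 + δ/2}`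
  and the "density" `P_{k/2} = P_{k/2}(T) := ((T/2π) log T)⁻¹ |B_{k/2}|`.
* **Theorem 1** (p0004:L7–L18): "Assume the Riemann Hypothesis and AH-Pairs. As `T → ∞`, we have
  `1 + o(1) ≤ P_0 ≤ 3/2 − 2/π² + o(1)`, and for `k ∈ ℤ` and `k ≠ 0` we have
  `P_{k/2} ∼ P_0 − ½` if `k ≠ 0` is even, `∼ 3/2 − 2/(π²k²) − P_0` if `k` is odd."
  (Proof, p0010:L65–L77: "We now take `T` and then `M` large … and conclude
  `P_0 + (−1)^{n+1} P_{n/2} ∼ ½` (`n` even), `3/2 − 2/(π²n²)` (`n` odd)".)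
* (p0004:L24–L26) `p_{k/2} := lim_{T→∞} P_{k/2}(T)` (the "limiting densities", when they exist).
* **(ESH)** (p0004:L32–L33): "Almost all the zeros of the Riemann zeta-function are simple.
  Moreover, almost all of the distinct zeros are not spaced arbitrarily closer together than the
  average spacing." ("We expect that `p_0 = 1`, which under RH, is a reformulation of the following
  conjecture, see [Mue83]".)
* §1 (p0004:L37–L47): **(Strong AH-Pairs)** "Suppose `𝓜` is a positive real number which we can
  take as large as we wish, and let `R(T)` be a positive decreasing function such that
  `R(T) log T → 0` as `T → ∞`. Define `𝒬(T, 𝓜) := {(γ, γ') : T/log²T < γ, γ' ≤ T, |γ − γ'| ≤ 𝓜}`.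
  Then for every `(γ, γ') ∈ 𝒬(T, 𝓜)` there is an integer `k ≪ 𝓜 log T` such that
  `(γ − γ')(log T)/2π = k/2 + O((|k| + 1) R(T))`."
* **Theorem 2** (p0004:L49–L55): "Assume that the Riemann Hypothesis and the Strong AH-Pairs hold.
  Then `p_0 = lim_{T→∞} P_0 = 1`, and thus the Essential Simplicity Hypothesis is true."
* **(MT)** (p0004:L66–L73) = Montgomery's theorem with the Goldston–Montgomery error term: CITED,
  not retyped — the tree's `montgomery_pair_correlation_restricted` (`RHConditionalFacts.lean`)
  is Montgomery's 1973 form (`o(1)` errors, `|α| ≤ 1 − δ`); BGSTB's (MT) is the refinement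
  "`F(α) = T^{−2α} log T (1 + O(1/√log T)) + α + O(1/√log T)` uniformly for `0 ≤ α ≤ 1`"
  (Remark 5: "we have removed an extraneous factor of `log log T` from [GM87]"). The difference is
  recorded here, not typed (lead ruling ASSIGNMENTS t5).
* **(AH-Density)** (p0005:L1–L14, a CONJECTURE, typed as a predicate): "The limiting densities
  `p_{k/2}` exist and satisfy `1 ≤ p_0 ≤ 3/2 − 2/π²`, and for `k ∈ ℤ`, `p_{k/2} = p_0 − ½` if
  `k ≠ 0` is even, `= 3/2 − 2/(π²k²) − p_0` if `k` is odd."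
* **(MT-Pairs)** (§2, p0006:L70–L94): for `g ∈ L¹(ℝ)`, `ĝ(t) = ∫ g(α) e(−tα) dα`; "Assuming the
  Riemann Hypothesis, `∑_{0<γ,γ'≤T} ĝ(((γ−γ')/2π) log T) w(γ−γ') = ((T/2π) log T) ∫ F(α) g(α) dα`.
  If we assume in addition that `g(α)` is even with support in `|α| ≤ 1`, and `g(α)` is Lipschitz
  continuous at `α = 0`, then …
  `∑_{0<γ,γ'≤T} ĝ(((γ−γ')/2π) log T) w(γ−γ') = (T/2π) log T (g(0) + 2∫₀¹ α g(α) dα + O(1/√log T))`."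
  ("Recall that `f` is Lipschitz continuous at `x = a` if there are constants `C > 0` and `δ > 0`
  such that `|f(x) − f(a)| ≤ C|x − a|` for all `|x − a| < δ`", p0006:L68.)
* **Corollary 1** (p0006:L111–L125), **Corollary 2** (p0006:L130–p0007:L5), **Corollary 3**
  (p0007:L7–L17): quoted in the docstrings below.

**[LR20]** J. C. Lagarias, B. Rodgers, *Higher correlations and the alternative hypothesis*,
Q. J. Math. 71 (2020), 257–280 (held TeX text `paper:arxiv-1905.12123`, chunks p0004–p0006):

* §2.1 (p0004:L11): `γ̃_j = γ_j log|γ_j| / 2π` (= the tree's `normalizedOrdinate`).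
* **Conjecture 2.2** (p0004:L72–L80): "For all sufficiently large `j`, `γ̃_{j+1} − γ̃_j = h_j + o(1)`,
  with `h_j` an element of the set `{½, 1, 3/2, 2, …}` for all `j`."
* (2.3) (p0004:L91–L100, an informal implication, recorded as a REMARK only): "the Alternative
  Hypothesis can be shown to imply `(1/T) ∑_{0 ≤ γ̃_j, γ̃_k ≤ T} f(γ̃_j − γ̃_k) ∼ ∫ f̂(ξ) K_Alt(ξ) dξ`
  for `K_Alt(ξ) := δ_0(ξ) + |ξ|` for `ξ ∈ [−1, 1]`, and defined by periodicity elsewhere" (LR cite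
  Baluyot 2016, Cor. 1.4, "stated in a slightly different form there"; the precise hypotheses are
  Baluyot's and are typed by t6 from that source). Only the 2-periodic function `s(ξ) = |ξ|`
  (`|ξ| ≤ 1`), which is also BGSTB's `s(α)` of (calF) (p0008:L20), is defined here (`triangleWave`).
* **Theorem 2.3** (density, unconditional) and **Theorem 2.4** (band-limited `n`-correlations on
  RH; Montgomery–Hejhal–Rudnick–Sarnak) are CITED: the tree's `rudnick_sarnak`
  (`RHConditionalFacts.lean`, Rudnick–Sarnak's formalism) — not retyped.
* §2.4 (p0005:L12–L16): `𝒦_n` = "band-limited test functions `η ∈ 𝒮(ℝⁿ)` whose Fourier transform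
  has support `supp η̂ ⊂ {ξ ∈ ℝⁿ : ξ_1 + ⋯ + ξ_n ≠ 0 or |ξ_1| + ⋯ + |ξ_n| < 2}`" (footnote p0005:L8:
  "By a bandlimited function on `ℝⁿ` we mean a function that has a compactly supported Fourier
  transform"); `S(x) = sin πx/(πx)` (`S(0) = 1`) = the tree's `sineKernel`.
* **Theorem 3.1** (p0006:L9–L29): "There exists a (deterministic) sequence of points `{c_j}_{j∈ℤ}`
  on the real line such that `c_{j+1} − c_j ∈ {½, 1, 3/2, 2, …}` for all `j`, and moreover for any
  `φ ∈ 𝒮(ℝ)`, `lim_{T→∞} (1/T) ∫_T^{2T} ∑_{j∈ℤ} φ(c_j − t) dt = ∫_ℝ φ(x) dx`, and for each `n ≥ 2`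
  and any `η ∈ 𝒦_n`,
  `lim_{T→∞} (1/T) ∫_T^{2T} ∑_{j_1,…,j_n distinct} η(c_{j_1} − t, …, c_{j_n} − t) dt
   = ∫_{ℝⁿ} η(x) det_{1≤i,j≤n}[S(x_i − x_j)] dⁿx`." A published, unconditional theorem (named
  fact; its proof is the AH point process of LR §§4–7, not in the tree).

## Lean rendering / design choices

* Zeros are the tree's ordinates `zetaOrdinate : ℕ → ℝ` (0-indexed, non-decreasing, with
  multiplicity); "`0 < γ ≤ T`" = index in `zeroIndexSet T` (as in `pairCorrelationCount`,
  `montgomeryFormFactor`); a PAIR `(γ, γ')` is a pair of indices, so pairs are counted with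
  multiplicity exactly as in BGSTB (Remark 1). `γ̃` = `normalizedOrdinate`. BGSTB's "`n ≥ 1`" is our
  "all `n : ℕ`".
* The normalised difference `((γ − γ')/2π) log T` of a pair is `AH.pairSpacing T p`.
* `O(·)` constants are made explicit (`∃ C`), as are the "positive decreasing `R(T) → 0`" data of
  (AH-Pairs) (`Antitone`; any positive `R → 0` has an antitone majorant `sup_{t ≥ T} R(t) → 0`, so
  this is no restriction). "`M` as large as we wish … then for every pair in `𝒫(T, M)`": for EVERY
  `M > 0` there are such `R = R_M`, `C = C_M` (Lemma 1 of BGSTB derives AH-Pairs from AH with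
  `R(T) = Ψ(T)/log T + M/T + log log T/log T`, which depends on `M`); the conclusion is asked for
  all sufficiently large `T` (`∀ᶠ T in atTop`) — equivalent to "all `T ≥ 3`" after enlarging `C`,
  since `|pairSpacing| ≤ M` on `𝒫(T, M)` and `R` is positive and non-increasing; the printed side
  remark "`k ≪ M`" / "`k ≪ 𝓜 log T`" is a consequence (for large `T`), not part of the predicate.
* `B_{k/2}(T, M, δ) ⊆ 𝒫(T, M)` is typed literally (`AH.bin k T M δ`), with `k : ℤ`; it does not
  depend on `M` once `M ≥ (|k| + δ)/2` (`AH.bin_eq_bin_of_le`, proved), which is why the paper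
  writes `P_{k/2}(T)`. Statements "as `T → ∞`" that the paper makes after "taking `M` large" are
  typed with `∀ᶠ M in atTop` in front of the `T`-limit; "the limiting density `p_{k/2}` exists (and
  equals `p`)" is `AH.HasLimitingDensity k δ p`. The bin half-width `δ ∈ (0, 1/2]` is an explicit
  parameter throughout (the paper fixes it once).
* Theorem 1's "`P_{k/2} ∼ P_0 − ½`" etc. is typed as what the proof establishes (p0010:L67):
  `P_0 − P_{k/2} → ½` (`k ≠ 0` even), `P_0 + P_{k/2} → 3/2 − 2/(π²k²)` (`k` odd) — for `k` odd the
  printed right-hand side `3/2 − 2/(π²k²) − P_0` may tend to `0` (Corollary 3: `p_{1/2} = 0`), where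
  `∼` has no other meaning.
* (ESH) is printed informally by BGSTB; we type the precise classical form (Mueller 1983, as
  printed in Ivić 2002, (32)–(33)): the number of ordered pairs `0 < γ, γ' ≤ T` (with multiplicity,
  diagonal included) with `|γ − γ'| ≤ 2πα/log T` is `≤ (1 + ε) N(T)` for all large `T` once `α` is
  small — in the tree's vocabulary `pairCorrelationCount (−α) α T`. The diagonal alone contributes
  `≥ N(T)`, so this says both "almost all zeros are simple" and "close distinct pairs are rare".
  Theorem 2 is typed with its proved conclusion `p_0 = 1`; "and thus ESH" is BGSTB's gloss (under
  RH), left to a separate lemma.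
* (MT-Pairs): `ĝ` = Mathlib's Fourier transform `𝓕` (`𝓕 f w = ∫ e(−vw) f(v) dv`, the same
  convention), applied to `g : ℝ → ℝ` cast to `ℂ`; the first display (the identity
  `∑ ĝ w = ((T/2π) log T) ∫ F g`) is Fubini for a finite sum and holds without RH — it is left to
  the discharge layer as a theorem, not typed as a fact; the typed fact is the second display with
  its `O(1/√log T)` made explicit (`∃ C, ∀ᶠ T`).
* LR's `𝒦_n`: `η` a Schwartz map on `EuclideanSpace ℝ (Fin n)` (Mathlib's Fourier transform needs
  an inner-product space) with `𝓕 η` compactly supported and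
  `tsupport (𝓕 η) ⊆ {ξ | ∑ ξ_i ≠ 0 ∨ ∑ |ξ_i| < 2}`; the distinct sum over `j_1, …, j_n ∈ ℤ` is a
  `tsum` over embeddings `Fin n ↪ ℤ`; `(1/T) ∫_T^{2T}` is an interval integral.
* Typer lint: no instances, no notation, no attribute changes; every object was searched
  (`lean search`): the tree has no Alternative-Hypothesis vocabulary beyond
  `HalfIntegerGapDistribution` (`SiegelZerosSmallZetaGaps.lean`, the `zetaNormalizedGap`-form of
  LR's Conjecture 2.2 — see the docstring of `AlternativeHypothesisLR` for the exact relation).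

## What is NOT here

BGSTB Theorem 3 / (calF), Corollary 4, Theorem 4, Lemma 5 (Heath-Brown's `G_λ`), Corollary 5
(second wave, form-factor file); Lemmas 1–4 of BGSTB §2 (proof-internal); Baluyot 2016,
Goldston–Lee–Schettler–Suriajaya 2026, Aryan 2019 (t6, `AlternativeHypothesisConsequences.lean`);
LR Theorems 4.7/5.3/8.1 (point processes; optional second wave); any discharge of the BGSTB
claims themselves (Theorem 1, Theorem 2, MT-Pairs) or of LR Theorem 3.1. PROVED here (§5): Strong
AH-Pairs ⇒ AH-Pairs; Corollary 1 (both parts), 2, 3 from Theorem 1.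

## References

* [BaluyotGoldstonSuriajayaTurnageButterbaugh2025] arXiv:2508.10857 — §1 (AH), (AH-Pairs),
  (B_{k/2}), Theorem 1, (ESH), (Strong AH-Pairs), Theorem 2, (MT), (AH-Density); §2 Lemma 1,
  (MT-Pairs), Corollaries 1–3. UNREFEREED (claims under review).
* [LagariasRodgers2020] Q. J. Math. 71 (2020) 257–280 — Conjecture 2.2, (2.3), Theorems 2.3, 2.4,
  §2.4 (`𝒦_n`), Theorem 3.1.
* [Ivic2002SmallValues] A. Ivić, Liet. Mat. Rink. 42 (2002) 31–45 (arXiv:math/0312097), (32)–(33)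
  (the essential simplicity hypothesis); [Mueller1983] J. Mueller, Trans. AMS 275 (1983) 175–183
  (original formulation; not held, acq-11218).
* [Montgomery1973] (the tree's `montgomeryFormFactor`, `montgomeryWeight`,
  `montgomery_pair_correlation_restricted`); [RudnickSarnak1996] (the tree's `rudnick_sarnak`).
-/

noncomputable section

open Filter Set MeasureTheory Asymptotics
open scoped Real Topology FourierTransform

namespace Literature.NumberTheory.LFunctions

/-! ## §1. Pairs of zeros: `𝒫(T, M)`, `B_{k/2}`, `P_{k/2}` (BGSTB 2025, §1) -/

namespace AH

/-- The normalised difference `((γ − γ')/2π) · log T` of the pair of ordinates with indices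
`p = (i, j)`: `(γ_i − γ_j) log T/(2π)` — "in units of the average spacing `2π/log T`"
(BGSTB 2025, §1, display (𝒫(T, M))). [cite: BaluyotGoldstonSuriajayaTurnageButterbaugh2025, §1 (P(T,M))] -/
def pairSpacing (T : ℝ) (p : ℕ × ℕ) : ℝ :=
  (zetaOrdinate p.1 - zetaOrdinate p.2) * Real.log T / (2 * π)

/-- Swapping the pair changes the sign of the normalised difference. [cite: BaluyotGoldstonSuriajayaTurnageButterbaugh2025, §1 (P(T,M))] -/
theorem pairSpacing_swap (T : ℝ) (p : ℕ × ℕ) : pairSpacing T p.swap = -pairSpacing T p := by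
  simp [pairSpacing]
  ring

open scoped Classical in
/-- **`𝒫(T, M)`** (BGSTB 2025, §1): the pairs `(γ, γ')` of ordinates, counted with multiplicity
(pairs of indices in `zeroIndexSet T`, i.e. `0 < γ, γ' ≤ T`), with `T/log²T < γ, γ' ≤ T` and
`|((γ − γ')/2π) log T| ≤ M`. [cite: BaluyotGoldstonSuriajayaTurnageButterbaugh2025, §1 (P(T,M))] -/
def pairs (T M : ℝ) : Finset (ℕ × ℕ) :=
  (zeroIndexSet T ×ˢ zeroIndexSet T).filter fun p ↦
    T / Real.log T ^ 2 < zetaOrdinate p.1 ∧ T / Real.log T ^ 2 < zetaOrdinate p.2 ∧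
      |pairSpacing T p| ≤ M

open scoped Classical in
/-- Membership in `𝒫(T, M)`, unfolded. [cite: BaluyotGoldstonSuriajayaTurnageButterbaugh2025, §1 (P(T,M))] -/
theorem mem_pairs {T M : ℝ} {p : ℕ × ℕ} :
    p ∈ pairs T M ↔ p ∈ zeroIndexSet T ×ˢ zeroIndexSet T ∧
      T / Real.log T ^ 2 < zetaOrdinate p.1 ∧ T / Real.log T ^ 2 < zetaOrdinate p.2 ∧
        |pairSpacing T p| ≤ M := by
  simp [pairs]

/-- `𝒫(T, M)` increases with `M`. [cite: BaluyotGoldstonSuriajayaTurnageButterbaugh2025, §1 (P(T,M))] -/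
theorem pairs_mono {T M M' : ℝ} (h : M ≤ M') : pairs T M ⊆ pairs T M' := by
  intro p hp
  rw [mem_pairs] at hp ⊢
  exact ⟨hp.1, hp.2.1, hp.2.2.1, hp.2.2.2.trans h⟩

open scoped Classical in
/-- **`B_{k/2}(T, M, δ)`** (BGSTB 2025, §1, display (B_{k/2}), "for any fixed number
`0 < δ ≤ 1/2`"): the pairs in `𝒫(T, M)` whose normalised difference is closest to the half-integer
`k/2`: `k/2 − δ/2 < ((γ − γ')/2π) log T ≤ k/2 + δ/2` (half-open, as printed). Typed for every
`k : ℤ` and every `δ`. [cite: BaluyotGoldstonSuriajayaTurnageButterbaugh2025, §1 (B_{k/2})] -/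
def bin (k : ℤ) (T M δ : ℝ) : Finset (ℕ × ℕ) :=
  (pairs T M).filter fun p ↦ (k : ℝ) / 2 - δ / 2 < pairSpacing T p ∧ pairSpacing T p ≤ k / 2 + δ / 2

/-- **`P_{k/2}(T) := ((T/2π) log T)⁻¹ |B_{k/2}|`**, the "density" of pairs closest to `k/2`
(BGSTB 2025, §1). It carries the parameters `M`, `δ` of `B_{k/2}(T, M, δ)`; it is independent of
`M` once `M ≥ (|k| + δ)/2` (`bin_eq_bin_of_le`). (The printed "`P_{k/2} = P_{−k/2}` for all
`k ∈ ℤ`" holds by the swap `(γ, γ') ↦ (γ', γ)` up to pairs whose normalised difference is exactly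
a bin edge `k/2 ± δ/2`, because the bins are half-open; it is not used below.)
[cite: BaluyotGoldstonSuriajayaTurnageButterbaugh2025, §1 (P_{k/2})] -/
def binDensity (k : ℤ) (T M δ : ℝ) : ℝ :=
  ((bin k T M δ).card : ℝ) / (T / (2 * π) * Real.log T)

open scoped Classical in
/-- Membership in `B_{k/2}(T, M, δ)`, unfolded. [cite: BaluyotGoldstonSuriajayaTurnageButterbaugh2025, §1 (B_{k/2})] -/
theorem mem_bin {k : ℤ} {T M δ : ℝ} {p : ℕ × ℕ} :
    p ∈ bin k T M δ ↔
      p ∈ pairs T M ∧ (k : ℝ) / 2 - δ / 2 < pairSpacing T p ∧ pairSpacing T p ≤ k / 2 + δ / 2 := by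
  simp [bin]

/-- `B_{k/2}(T, M, δ) ⊆ 𝒫(T, M)`. [cite: BaluyotGoldstonSuriajayaTurnageButterbaugh2025, §1 (B_{k/2})] -/
theorem bin_subset_pairs (k : ℤ) (T M δ : ℝ) : bin k T M δ ⊆ pairs T M :=
  Finset.filter_subset _ _

/-- The bin condition `k/2 − δ/2 < x ≤ k/2 + δ/2` gives `|x| ≤ (|k| + δ)/2` (arithmetic helper). [folklore] -/
private theorem abs_le_of_bin_cond {k : ℤ} {δ x : ℝ} (h3 : (k : ℝ) / 2 - δ / 2 < x)
    (h4 : x ≤ k / 2 + δ / 2) : |x| ≤ (|(k : ℝ)| + δ) / 2 := by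
  have hk : -|(k : ℝ)| ≤ (k : ℝ) ∧ (k : ℝ) ≤ |(k : ℝ)| := ⟨neg_abs_le _, le_abs_self _⟩
  rw [abs_le]
  constructor <;> linarith [hk.1, hk.2]

/-- A pair in `B_{k/2}` has `|((γ − γ')/2π) log T| ≤ (|k| + δ)/2`. [cite: BaluyotGoldstonSuriajayaTurnageButterbaugh2025, §1 (B_{k/2})] -/
theorem abs_pairSpacing_le_of_mem_bin {k : ℤ} {T M δ : ℝ} {p : ℕ × ℕ}
    (hp : p ∈ bin k T M δ) : |pairSpacing T p| ≤ (|(k : ℝ)| + δ) / 2 := by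
  obtain ⟨-, h1, h2⟩ := mem_bin.mp hp
  exact abs_le_of_bin_cond h1 h2

/-- **`B_{k/2}(T, M, δ)` does not depend on `M` once `M ≥ (|k| + δ)/2`**: the constraint
`|((γ − γ')/2π) log T| ≤ M` of `𝒫(T, M)` is then implied by the bin condition. This is why BGSTB
write `P_{k/2}(T)`. [cite: BaluyotGoldstonSuriajayaTurnageButterbaugh2025, §1 (B_{k/2})] -/
theorem bin_eq_bin_of_le {k : ℤ} {T M M' δ : ℝ} (hM : (|(k : ℝ)| + δ) / 2 ≤ M)
    (hM' : (|(k : ℝ)| + δ) / 2 ≤ M') : bin k T M δ = bin k T M' δ := by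
  ext p
  simp only [mem_bin, mem_pairs]
  constructor
  · rintro ⟨⟨hp, h1, h2, -⟩, h3, h4⟩
    exact ⟨⟨hp, h1, h2, (abs_le_of_bin_cond h3 h4).trans hM'⟩, h3, h4⟩
  · rintro ⟨⟨hp, h1, h2, -⟩, h3, h4⟩
    exact ⟨⟨hp, h1, h2, (abs_le_of_bin_cond h3 h4).trans hM⟩, h3, h4⟩

/-- Consequently `P_{k/2}(T, M, δ) = P_{k/2}(T, M', δ)` for `M, M' ≥ (|k| + δ)/2`. [cite: BaluyotGoldstonSuriajayaTurnageButterbaugh2025, §1 (P_{k/2})] -/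
theorem binDensity_eq_binDensity_of_le {k : ℤ} {T M M' δ : ℝ}
    (hM : (|(k : ℝ)| + δ) / 2 ≤ M) (hM' : (|(k : ℝ)| + δ) / 2 ≤ M') :
    binDensity k T M δ = binDensity k T M' δ := by
  rw [binDensity, binDensity, bin_eq_bin_of_le hM hM']

/-- **"The limiting density `p_{k/2} := lim_{T→∞} P_{k/2}(T)` exists" and equals `p`**
(BGSTB 2025, §1, display (p_{k/2})): for all sufficiently large `M` (equivalently, by
`bin_eq_bin_of_le`, for any one `M ≥ (|k| + δ)/2`), `P_{k/2}(T, M, δ) → p` as `T → ∞`. A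
predicate. [cite: BaluyotGoldstonSuriajayaTurnageButterbaugh2025, §1 (p_{k/2})] -/
def HasLimitingDensity (k : ℤ) (δ p : ℝ) : Prop :=
  ∀ᶠ M : ℝ in atTop, Tendsto (fun T : ℝ ↦ binDensity k T M δ) atTop (𝓝 p)

/-- `HasLimitingDensity k δ p` is the `T`-limit at the single level `M = (|k| + δ)/2` (any larger
`M` gives the same bins). [cite: BaluyotGoldstonSuriajayaTurnageButterbaugh2025, §1 (p_{k/2})] -/
theorem hasLimitingDensity_iff {k : ℤ} {δ p : ℝ} :
    HasLimitingDensity k δ p ↔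
      Tendsto (fun T : ℝ ↦ binDensity k T ((|(k : ℝ)| + δ) / 2) δ) atTop (𝓝 p) := by
  constructor
  · intro h
    obtain ⟨M, hM⟩ := (h.and (eventually_ge_atTop ((|(k : ℝ)| + δ) / 2))).exists
    refine hM.1.congr fun T ↦ ?_
    exact binDensity_eq_binDensity_of_le hM.2 le_rfl
  · intro h
    filter_upwards [eventually_ge_atTop ((|(k : ℝ)| + δ) / 2)] with M hM
    refine h.congr fun T ↦ ?_
    exact binDensity_eq_binDensity_of_le le_rfl hM

/-- Limiting densities are unique. [cite: BaluyotGoldstonSuriajayaTurnageButterbaugh2025, §1 (p_{k/2})] -/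
theorem HasLimitingDensity.unique {k : ℤ} {δ p q : ℝ} (hp : HasLimitingDensity k δ p)
    (hq : HasLimitingDensity k δ q) : p = q :=
  tendsto_nhds_unique (hasLimitingDensity_iff.mp hp) (hasLimitingDensity_iff.mp hq)

open scoped Classical in
/-- **`𝒬(T, 𝓜)`** (BGSTB 2025, §1, before Theorem 2): the pairs `(γ, γ')` (with multiplicity,
`0 < γ, γ' ≤ T`) with `T/log²T < γ, γ' ≤ T` and `|γ − γ'| ≤ 𝓜` — differences up to a BOUNDED size
rather than `≪ 1/log T`. [cite: BaluyotGoldstonSuriajayaTurnageButterbaugh2025, §1 (Q(T,M))] -/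
def nearPairs (T 𝓜 : ℝ) : Finset (ℕ × ℕ) :=
  (zeroIndexSet T ×ˢ zeroIndexSet T).filter fun p ↦
    T / Real.log T ^ 2 < zetaOrdinate p.1 ∧ T / Real.log T ^ 2 < zetaOrdinate p.2 ∧
      |zetaOrdinate p.1 - zetaOrdinate p.2| ≤ 𝓜

open scoped Classical in
/-- Membership in `𝒬(T, 𝓜)`, unfolded. [cite: BaluyotGoldstonSuriajayaTurnageButterbaugh2025, §1 (Q(T,M))] -/
theorem mem_nearPairs {T 𝓜 : ℝ} {p : ℕ × ℕ} :
    p ∈ nearPairs T 𝓜 ↔ p ∈ zeroIndexSet T ×ˢ zeroIndexSet T ∧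
      T / Real.log T ^ 2 < zetaOrdinate p.1 ∧ T / Real.log T ^ 2 < zetaOrdinate p.2 ∧
        |zetaOrdinate p.1 - zetaOrdinate p.2| ≤ 𝓜 := by
  simp [nearPairs]

/-- The AH-Density table (BGSTB 2025, (AH-Density) and Corollary 1): the value of `p_{k/2}`
predicted from `p_0`: `p_0` at `k = 0`, `p_0 − ½` for `k ≠ 0` even, `3/2 − 2/(π²k²) − p_0` for `k`
odd. [cite: BaluyotGoldstonSuriajayaTurnageButterbaugh2025, §1 (AH-Density)] -/
def densityTable (p₀ : ℝ) (k : ℤ) : ℝ :=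
  if k = 0 then p₀ else if Even k then p₀ - 1 / 2 else 3 / 2 - 2 / (π ^ 2 * (k : ℝ) ^ 2) - p₀

/-- `densityTable p₀ 0 = p₀`. [cite: BaluyotGoldstonSuriajayaTurnageButterbaugh2025, §1 (AH-Density)] -/
@[simp] theorem densityTable_zero (p₀ : ℝ) : densityTable p₀ 0 = p₀ := by
  simp [densityTable]

/-- `densityTable p₀ k = p₀ − ½` for `k ≠ 0` even. [cite: BaluyotGoldstonSuriajayaTurnageButterbaugh2025, §1 (AH-Density)] -/
theorem densityTable_of_even {p₀ : ℝ} {k : ℤ} (hk : k ≠ 0) (he : Even k) :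
    densityTable p₀ k = p₀ - 1 / 2 := by
  simp [densityTable, hk, he]

/-- `densityTable p₀ k = 3/2 − 2/(π²k²) − p₀` for `k` odd. [cite: BaluyotGoldstonSuriajayaTurnageButterbaugh2025, §1 (AH-Density)] -/
theorem densityTable_of_odd {p₀ : ℝ} {k : ℤ} (ho : Odd k) :
    densityTable p₀ k = 3 / 2 - 2 / (π ^ 2 * (k : ℝ) ^ 2) - p₀ := by
  have hk : k ≠ 0 := by rintro rfl; exact Int.not_odd_zero ho
  simp [densityTable, hk, Int.not_even_iff_odd.mpr ho]

end AH

/-! ## §2. The Alternative Hypothesis and its variants (predicates; never asserted) -/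

/-- **The Alternative Hypothesis, Baluyot's form (AH), for a given error function `ψ`**
(BGSTB 2025, §1, after Baluyot 2016): "For each integer `n ≥ 1` there exists an integer `k_n ≥ 0`
with `γ̃_{n+1} − γ̃_n = ½ k_n + O(|γ_{n+1} − γ_n| · ψ(γ_n))`." The `O`-constant is an explicit
`∃ C`; `γ̃ = normalizedOrdinate`, `γ = zetaOrdinate` (0-indexed, so "`n ≥ 1`" is every `n : ℕ`).
A predicate on `ψ`; the printed side conditions on `ψ` are in `AlternativeHypothesisBal16`.
[cite: BaluyotGoldstonSuriajayaTurnageButterbaugh2025, §1 (AH)] -/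
def AlternativeHypothesisBal16At (ψ : ℝ → ℝ) : Prop :=
  ∃ C : ℝ, ∀ n : ℕ, ∃ k : ℕ,
    |normalizedOrdinate (n + 1) - normalizedOrdinate n - (k : ℝ) / 2| ≤
      C * |zetaOrdinate (n + 1) - zetaOrdinate n| * ψ (zetaOrdinate n)

/-- **The Alternative Hypothesis (AH)** in Baluyot's 2016 formulation as printed in BGSTB 2025,
§1 (p0003:L25–L32): there is "a positive function `ψ(γ)` such that `ψ(γ) → ∞` and
`ψ(γ) = o(log γ)` as `γ → ∞`" with, for each `n`, an integer `k_n ≥ 0` such that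
`γ̃_{n+1} − γ̃_n = ½ k_n + O(|γ_{n+1} − γ_n| ψ(γ_n))`. A HYPOTHESIS (BGSTB: "completely counter to
the experimental evidence … and yet cannot be disproved at present"), typed as a predicate and never
asserted. (Does not assume RH: a statement about ordinates only, Remark 3.)
[cite: BaluyotGoldstonSuriajayaTurnageButterbaugh2025, §1 (AH)] -/
def AlternativeHypothesisBal16 : Prop :=
  ∃ ψ : ℝ → ℝ, (∀ x, 0 < ψ x) ∧ Tendsto ψ atTop atTop ∧ ψ =o[atTop] Real.log ∧
    AlternativeHypothesisBal16At ψ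

/-- **The Alternative Hypothesis, Lagarias–Rodgers form** (LR 2020, §2.3, statement 2.2 "The
Alternative Hypothesis", as printed): "For all sufficiently large `j`, `γ̃_{j+1} − γ̃_j = h_j + o(1)`,
with `h_j` an element of the set `{½, 1, 3/2, 2, …}` for all `j`"
(`γ̃_j = γ_j log γ_j/2π = normalizedOrdinate j`): there is a sequence of positive integers `k_j` with
`γ̃_{j+1} − γ̃_j − k_j/2 → 0`. (LR: "almost certainly it is false! Clearly it is contradicted by the
GUE Hypothesis" — the tree's `GUEHypothesis`; "no one has been able to disprove" it.) A HYPOTHESIS,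
typed as a predicate to be consumed as an assumption, never asserted. RELATION to the tree's
`HalfIntegerGapDistribution` (`SiegelZerosSmallZetaGaps.lean`), which says the same for the gaps
`δ_n = (γ_{n+1} − γ_n) log γ_n/2π = zetaNormalizedGap n` in "`∀ ε, ∀ᶠ n, ∃ k ≥ 1, |δ_n − k/2| ≤ ε`"
form: `γ̃_{n+1} − γ̃_n = δ_n + γ_{n+1} log(γ_{n+1}/γ_n)/2π` and the correction is `≥ 0` and
`≤ (γ_{n+1} − γ_n) · γ_{n+1}/(2π γ_n)`, which tends to `0` exactly when the raw gaps `γ_{n+1} − γ_n`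
do (true: `γ_{n+1} − γ_n ≪ 1/log log log γ_n`, Littlewood; not in the tree); so the two predicates
agree given that input, and the `∃ (k_j)`-form and the `∀ ε ∃ k`-form agree by choosing `k_j` nearest.
Neither implication is asserted here. [cite: LagariasRodgers2020, §2.3 (2.2)] -/
def AlternativeHypothesisLR : Prop :=
  ∃ k : ℕ → ℕ, (∀ j, 1 ≤ k j) ∧
    Tendsto (fun j : ℕ ↦ normalizedOrdinate (j + 1) - normalizedOrdinate j - (k j : ℝ) / 2)
      atTop (𝓝 0)

/-- **AH-Pairs at level `M`** (BGSTB 2025, §1, (AH-Pairs) with display (AH2k)): there are a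
positive non-increasing `R(T) → 0` and a constant `C` such that, for all sufficiently large `T`,
every pair `(γ, γ') ∈ 𝒫(T, M)` has an integer `k` with
`|((γ − γ')/2π) log T − k/2| ≤ C (|k| + 1) R(T)` ("`= k/2 + O((|k| + 1) R(T))`"). See the module
docstring for the quantifier conventions. A predicate. [cite: BaluyotGoldstonSuriajayaTurnageButterbaugh2025, §1 (AH-Pairs)] -/
def AHPairsAt (M : ℝ) : Prop :=
  ∃ R : ℝ → ℝ, (∀ T, 0 < R T) ∧ Antitone R ∧ Tendsto R atTop (𝓝 0) ∧
    ∃ C : ℝ, ∀ᶠ T : ℝ in atTop, ∀ p ∈ AH.pairs T M, ∃ k : ℤ,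
      |AH.pairSpacing T p - (k : ℝ) / 2| ≤ C * (|(k : ℝ)| + 1) * R T

/-- **AH-Pairs** (BGSTB 2025, §1: "Suppose `M` is a positive real number that we can take as large
as we wish …"): AH-Pairs holds at every level `M > 0`. The modified Alternative Hypothesis for
differences of not necessarily consecutive zeros used throughout BGSTB 2025 ("implied by the
statement of AH given above", via Lemma 1 = Baluyot 2016). A HYPOTHESIS, typed as a predicate and
never asserted. [cite: BaluyotGoldstonSuriajayaTurnageButterbaugh2025, §1 (AH-Pairs)] -/
def AHPairs : Prop :=
  ∀ M : ℝ, 0 < M → AHPairsAt M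

/-- AH-Pairs at level `M'` implies AH-Pairs at every level `M ≤ M'` (same `R`, `C`:
`𝒫(T, M) ⊆ 𝒫(T, M')`). [cite: BaluyotGoldstonSuriajayaTurnageButterbaugh2025, §1 (AH-Pairs)] -/
theorem AHPairsAt.anti {M M' : ℝ} (hMM' : M ≤ M') (h : AHPairsAt M') : AHPairsAt M := by
  obtain ⟨R, hR0, hRa, hRt, C, hC⟩ := h
  refine ⟨R, hR0, hRa, hRt, C, ?_⟩
  filter_upwards [hC] with T hT p hp
  exact hT p (AH.pairs_mono hMM' hp)

/-- **Strong AH-Pairs at level `𝓜`** (BGSTB 2025, §1, before Theorem 2): there are a positive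
non-increasing `R(T)` with `R(T) log T → 0` and a constant `C` such that, for all sufficiently large
`T`, every pair `(γ, γ') ∈ 𝒬(T, 𝓜)` (`|γ − γ'| ≤ 𝓜`) has an integer `k` with
`|((γ − γ')/2π) log T − k/2| ≤ C (|k| + 1) R(T)`. (The printed "`k ≪ 𝓜 log T`" follows for large `T`
and is not part of the predicate.) [cite: BaluyotGoldstonSuriajayaTurnageButterbaugh2025, §1 (Strong AH-Pairs)] -/
def StrongAHPairsAt (𝓜 : ℝ) : Prop :=
  ∃ R : ℝ → ℝ, (∀ T, 0 < R T) ∧ Antitone R ∧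
    Tendsto (fun T : ℝ ↦ R T * Real.log T) atTop (𝓝 0) ∧
    ∃ C : ℝ, ∀ᶠ T : ℝ in atTop, ∀ p ∈ AH.nearPairs T 𝓜, ∃ k : ℤ,
      |AH.pairSpacing T p - (k : ℝ) / 2| ≤ C * (|(k : ℝ)| + 1) * R T

/-- **Strong AH-Pairs** (BGSTB 2025, §1: "Suppose `𝓜` is a positive real number which we can take as
large as we wish …"): Strong AH-Pairs at every level `𝓜 > 0`. A HYPOTHESIS, typed as a predicate and
never asserted. [cite: BaluyotGoldstonSuriajayaTurnageButterbaugh2025, §1 (Strong AH-Pairs)] -/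
def StrongAHPairs : Prop :=
  ∀ 𝓜 : ℝ, 0 < 𝓜 → StrongAHPairsAt 𝓜

/-- **AH-Density** (BGSTB 2025, §1, the hypothesis (AH-Density), with bin half-width `δ`): "The
limiting densities `p_{k/2}` exist and satisfy `1 ≤ p_0 ≤ 3/2 − 2/π²`, and for `k ∈ ℤ`,
`p_{k/2} = p_0 − ½` if `k ≠ 0` is even, `3/2 − 2/(π²k²) − p_0` if `k` is odd" ("which, upon
assuming the limiting densities exist, is a consequence of RH and AH-Pairs" — Corollary 1). A
HYPOTHESIS formulated by the source (the assumption of its Theorem 4), typed as a predicate to be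
consumed as an assumption, never asserted.
[cite: BaluyotGoldstonSuriajayaTurnageButterbaugh2025, §1 (AH-Density)] -/
def AHDensity (δ : ℝ) : Prop :=
  ∃ p₀ : ℝ, 1 ≤ p₀ ∧ p₀ ≤ 3 / 2 - 2 / π ^ 2 ∧
    ∀ k : ℤ, AH.HasLimitingDensity k δ (AH.densityTable p₀ k)

/-- **The Essential Simplicity Hypothesis (ESH).** BGSTB 2025, §1 print it informally: "Almost all
the zeros of the Riemann zeta-function are simple. Moreover, almost all of the distinct zeros are
not spaced arbitrarily closer together than the average spacing" (referring to Mueller 1983 for the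
precise form, of which "`p_0 = 1`" is a reformulation under RH). Typed in the precise classical form
(Mueller 1983; as printed in Ivić 2002, (32)–(33): "`∑_{0<γ,γ'≤T, 0<γ−γ'≤2πα/log(T/2π)} 1 = o(N(T))`
for `α = o(1)`, together with `∑_{0<γ≤T} m(γ) = (1 + o(1)) N(T)`", `γ` counted with multiplicity):
for every `ε > 0` there is `α > 0` such that, for all large `T`, the number of ordered pairs of
ordinates `0 < γ, γ' ≤ T` (with multiplicity, the diagonal `γ = γ'` included) with
`|γ − γ'| ≤ 2πα/log T` is at most `(1 + ε) N(T)` — in the tree's vocabulary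
`pairCorrelationCount (−α) α T ≤ (1 + ε) N(T)`. (The diagonal contributes `∑_γ m(γ) ≥ N(T)` and
the off-diagonal part is twice Ivić's sum (32), so this one inequality is (32) ∧ (33); `log T` vs
`log(T/2π)` is immaterial since the count is monotone in `α`.) Without RH "spacing" is the vertical
difference of ordinates (BGSTB, after (ESH)). A HYPOTHESIS, typed as a predicate, never asserted.
[cite: Ivic2002SmallValues, (32)–(33)] -/
def EssentialSimplicityHypothesis : Prop :=
  ∀ ε : ℝ, 0 < ε → ∃ α : ℝ, 0 < α ∧
    ∀ᶠ T : ℝ in atTop, (pairCorrelationCount (-α) α T : ℝ) ≤ (1 + ε) * zetaZeroCount T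

/-! ## §3. BGSTB 2025: Theorems 1 and 2, Corollaries 1–3, MT-Pairs (claims of an unrefereed
preprint; named `Prop`s taken as hypotheses, not proved here) -/

/-- **BGSTB 2025, Theorem 1** (arXiv preprint, UNDER REVIEW): "Assume the Riemann Hypothesis and
AH-Pairs. As `T → ∞`, we have `1 + o(1) ≤ P_0 ≤ 3/2 − 2/π² + o(1)`, and for `k ∈ ℤ` and `k ≠ 0`
we have `P_{k/2} ∼ P_0 − ½` if `k ≠ 0` is even, `P_{k/2} ∼ 3/2 − 2/(π²k²) − P_0` if `k` is odd."
Rendered (see the module docstring): for every bin half-width `0 < δ ≤ 1/2` and all sufficiently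
large `M`, (a) for every `ε > 0`, eventually `1 − ε ≤ P_0(T) ≤ 3/2 − 2/π² + ε`; (b) for `k ≠ 0`
even, `P_0(T) − P_{k/2}(T) → ½`, and for `k` odd, `P_0(T) + P_{k/2}(T) → 3/2 − 2/(π²k²)` (the form
the proof establishes, p0010:L67). The proof's iterated limit "take `T` and then `M` large"
(p0010:L65) IS this plain `T`-limit at every large `M`: `P_{k/2}(T, M, δ)` does not depend on
`M ≥ (|k| + δ)/2` (`AH.bin_eq_bin_of_le`), so a `limsup_T ≤ C k²/M²` valid for all large `M` is a
limit. CLAIM of an unrefereed source, not proved here.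
[claim: BaluyotGoldstonSuriajayaTurnageButterbaugh2025, status: under-review] -/
def bgstb2025_theorem1 : Prop :=
  RiemannHypothesis → AHPairs → ∀ δ : ℝ, 0 < δ → δ ≤ 1 / 2 →
    (∀ ε : ℝ, 0 < ε → ∀ᶠ M : ℝ in atTop, ∀ᶠ T : ℝ in atTop,
        1 - ε ≤ AH.binDensity 0 T M δ ∧ AH.binDensity 0 T M δ ≤ 3 / 2 - 2 / π ^ 2 + ε) ∧
    (∀ k : ℤ, k ≠ 0 → Even k → ∀ᶠ M : ℝ in atTop,
        Tendsto (fun T : ℝ ↦ AH.binDensity 0 T M δ - AH.binDensity k T M δ) atTop (𝓝 (1 / 2))) ∧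
    (∀ k : ℤ, Odd k → ∀ᶠ M : ℝ in atTop,
        Tendsto (fun T : ℝ ↦ AH.binDensity 0 T M δ + AH.binDensity k T M δ) atTop
          (𝓝 (3 / 2 - 2 / (π ^ 2 * (k : ℝ) ^ 2))))

/-- **BGSTB 2025, Theorem 2** (arXiv preprint, UNDER REVIEW): "Assume that the Riemann Hypothesis
and the Strong AH-Pairs hold. Then `p_0 = lim_{T→∞} P_0 = 1`, and thus the Essential Simplicity
Hypothesis is true." Typed with the proved conclusion `p_0 = 1` (for every bin half-width
`0 < δ ≤ 1/2`); "and thus ESH" (`EssentialSimplicityHypothesis`) is the source's gloss under RH and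
is left to a separate lemma. CLAIM of an unrefereed source, not proved here.
[claim: BaluyotGoldstonSuriajayaTurnageButterbaugh2025, status: under-review] -/
def bgstb2025_theorem2 : Prop :=
  RiemannHypothesis → StrongAHPairs → ∀ δ : ℝ, 0 < δ → δ ≤ 1 / 2 → AH.HasLimitingDensity 0 δ 1

/-- **BGSTB 2025, Corollary 1** (arXiv preprint, UNDER REVIEW): "Assume the Riemann Hypothesis and
AH-Pairs. In addition, assume that the limiting density `p_0` exists. Then
`1 ≤ p_0 ≤ 3/2 − 2/π²`, and for `k ∈ ℤ`, the limiting densities `p_{k/2}` all exist, and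
`p_{k/2} = p_0 − ½` if `k ≠ 0` is even, `3/2 − 2/(π²k²) − p_0` if `k` is odd." ("This corollary
follows immediately from Theorem 1" — a discharge target: `bgstb2025_theorem1 → bgstb2025_corollary1`.)
[claim: BaluyotGoldstonSuriajayaTurnageButterbaugh2025, status: under-review] -/
def bgstb2025_corollary1 : Prop :=
  RiemannHypothesis → AHPairs → ∀ δ : ℝ, 0 < δ → δ ≤ 1 / 2 → ∀ p₀ : ℝ,
    AH.HasLimitingDensity 0 δ p₀ →
      (1 ≤ p₀ ∧ p₀ ≤ 3 / 2 - 2 / π ^ 2) ∧ ∀ k : ℤ, AH.HasLimitingDensity k δ (AH.densityTable p₀ k)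

/-- **BGSTB 2025, Corollary 1, last sentence** (arXiv preprint, UNDER REVIEW): "The assumption that
`p_0` exists may be replaced with the assumption that `p_{k/2}` exists for any one value of `k` and
that will then imply all the densities exist for all `k`" — under RH and AH-Pairs, if some `p_{k/2}`
exists then `p_0` exists (and `bgstb2025_corollary1` applies).
[claim: BaluyotGoldstonSuriajayaTurnageButterbaugh2025, status: under-review] -/
def bgstb2025_corollary1_of_one : Prop :=
  RiemannHypothesis → AHPairs → ∀ δ : ℝ, 0 < δ → δ ≤ 1 / 2 → ∀ (k : ℤ) (p : ℝ),
    AH.HasLimitingDensity k δ p → ∃ p₀ : ℝ, AH.HasLimitingDensity 0 δ p₀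

/-- **BGSTB 2025, Corollary 2** (arXiv preprint, UNDER REVIEW): "Assuming the Riemann Hypothesis,
AH-Pairs, and `p_0 = 1`, we have `p_{k/2} = 1` if `k = 0`, `½` if `k ≠ 0` is even,
`½ − 2/(π²k²)` if `k` is odd." (`= AH.densityTable 1 k`; a discharge target from Corollary 1.)
[claim: BaluyotGoldstonSuriajayaTurnageButterbaugh2025, status: under-review] -/
def bgstb2025_corollary2 : Prop :=
  RiemannHypothesis → AHPairs → ∀ δ : ℝ, 0 < δ → δ ≤ 1 / 2 → AH.HasLimitingDensity 0 δ 1 →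
    ∀ k : ℤ, AH.HasLimitingDensity k δ
      (if k = 0 then 1 else if Even k then 1 / 2 else 1 / 2 - 2 / (π ^ 2 * (k : ℝ) ^ 2))

/-- **BGSTB 2025, Corollary 3** (arXiv preprint, UNDER REVIEW): "Assume the Riemann Hypothesis,
AH-Pairs, and that `p_0 = 3/2 − 2/π²`. Then we have `p_{k/2} = 3/2 − 2/π²` if `k = 0`, `1 − 2/π²`
if `k ≠ 0` is even, `(2/π²)(1 − 1/k²)` if `k` is odd. Note here that `p_{1/2} = 0`."
(`= AH.densityTable (3/2 − 2/π²) k`; a discharge target from Corollary 1.)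
[claim: BaluyotGoldstonSuriajayaTurnageButterbaugh2025, status: under-review] -/
def bgstb2025_corollary3 : Prop :=
  RiemannHypothesis → AHPairs → ∀ δ : ℝ, 0 < δ → δ ≤ 1 / 2 →
    AH.HasLimitingDensity 0 δ (3 / 2 - 2 / π ^ 2) →
      ∀ k : ℤ, AH.HasLimitingDensity k δ
        (if k = 0 then 3 / 2 - 2 / π ^ 2 else if Even k then 1 - 2 / π ^ 2
          else 2 / π ^ 2 * (1 - 1 / (k : ℝ) ^ 2))

/-- "`f` is Lipschitz continuous at a point `x = a` if there are constants `C > 0` and `δ > 0` such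
that `|f(x) − f(a)| ≤ C |x − a|` for all `x` in a neighborhood `|x − a| < δ` of `a`" (BGSTB 2025, §2,
before (MT-Pairs); `C > 0` may be taken WLOG). Mathlib has the global `LipschitzWith` /
`LipschitzOnWith`, not this pointwise notion. [cite: BaluyotGoldstonSuriajayaTurnageButterbaugh2025, §2 (before MT-Pairs)] -/
def IsLipschitzAt (f : ℝ → ℝ) (a : ℝ) : Prop :=
  ∃ C δ : ℝ, 0 < δ ∧ ∀ x : ℝ, |x - a| < δ → |f x - f a| ≤ C * |x - a|

/-- **BGSTB 2025, Montgomery's theorem for sums over pairs (MT-Pairs)**, second display (arXiv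
preprint, UNDER REVIEW; "a nearly immediate consequence of (MT)" with the Goldston–Montgomery error
term): for `g ∈ L¹(ℝ)` even, supported in `|α| ≤ 1` and Lipschitz continuous at `α = 0`, with
`ĝ(t) = ∫ g(α) e(−tα) dα` (Mathlib's `𝓕`), "assuming the Riemann Hypothesis,
`∑_{0<γ,γ'≤T} ĝ(((γ − γ')/2π) log T) w(γ − γ') = (T/2π) log T (g(0) + 2∫₀¹ α g(α) dα + O(1/√log T))`"
(`w = montgomeryWeight`; the `O`-constant, depending on `g`, is an explicit `∃ C`, for all large
`T`). The first display of (MT-Pairs), `∑ ĝ w = ((T/2π) log T) ∫ F(α) g(α) dα`, is an unconditional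
finite-sum/integral exchange and is not typed as a fact. CLAIM of an unrefereed source, not proved
here (its input (MT) with `O(1/√log T)` is Goldston–Montgomery 1987, stronger than the tree's
`montgomery_pair_correlation_restricted`). [claim: BaluyotGoldstonSuriajayaTurnageButterbaugh2025, status: under-review] -/
def bgstb2025_mtPairs : Prop :=
  RiemannHypothesis →
    ∀ g : ℝ → ℝ, Integrable g → (∀ a, g (-a) = g a) → (∀ a, 1 < |a| → g a = 0) →
      IsLipschitzAt g 0 →
        ∃ C : ℝ, ∀ᶠ T : ℝ in atTop,
          ‖(∑ p ∈ zeroIndexSet T ×ˢ zeroIndexSet T,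
              𝓕 (fun a : ℝ ↦ (g a : ℂ)) (AH.pairSpacing T p) *
                (montgomeryWeight (zetaOrdinate p.1 - zetaOrdinate p.2) : ℂ)) -
            (T / (2 * π) * Real.log T * (g 0 + 2 * ∫ a in (0 : ℝ)..1, a * g a) : ℝ)‖ ≤
          C * (T / (2 * π) * Real.log T) / Real.sqrt (Real.log T)

/-! ## §4. Lagarias–Rodgers 2020: the form factor's sawtooth, the class `𝒦_n`, Theorem 3.1 -/

/-- The 2-periodic sawtooth `s(ξ) = |ξ|` for `|ξ| ≤ 1`, `s(ξ + 2) = s(ξ)` — the distance from `ξ` to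
the nearest even integer, `|ξ − 2·round(ξ/2)|`: the absolutely continuous part of Lagarias–Rodgers'
form factor `K_Alt(ξ) = δ_0(ξ) + |ξ|` on `[−1, 1]` "defined by periodicity elsewhere" (LR 2020,
(2.3)), and BGSTB 2025's `s(α)` in (calF) ("`s(α) = |α|` for `|α| ≤ 1`, and `s(α + 2) = s(α)` for
all `α`"). LR's implication "(AH) ⇒ (1/T) ∑_{0≤γ̃_j,γ̃_k≤T} f(γ̃_j − γ̃_k) ∼ ∫ f̂ K_Alt" is printed
without its hypotheses (they are Baluyot 2016, Cor. 1.4) and is NOT typed here.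
[cite: LagariasRodgers2020, §2.3 (2.3)] -/
def triangleWave (ξ : ℝ) : ℝ :=
  |ξ - 2 * round (ξ / 2)|

/-- `s(ξ) = |ξ|` for `|ξ| ≤ 1`. [cite: LagariasRodgers2020, §2.3 (2.3)] -/
theorem triangleWave_of_abs_le_one {ξ : ℝ} (h : |ξ| ≤ 1) : triangleWave ξ = |ξ| := by
  unfold triangleWave
  rcases (abs_le.mp h).2.eq_or_lt with h1 | h1
  · subst h1; norm_num
  · have hr : round (ξ / 2) = 0 := by
      rw [round_eq_zero_iff]
      constructor <;> linarith [(abs_le.mp h).1]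
    simp [hr]

/-- `s(ξ + 2) = s(ξ)`. [cite: LagariasRodgers2020, §2.3 (2.3)] -/
theorem triangleWave_add_two (ξ : ℝ) : triangleWave (ξ + 2) = triangleWave ξ := by
  unfold triangleWave
  rw [show (ξ + 2) / 2 = ξ / 2 + 1 by ring]
  rw [show ξ / 2 + 1 = ξ / 2 + ((1 : ℤ) : ℝ) by norm_num, round_add_intCast]
  push_cast
  ring_nf

/-- `s(ξ) ≥ 0`. [cite: LagariasRodgers2020, §2.3 (2.3)] -/
theorem triangleWave_nonneg (ξ : ℝ) : 0 ≤ triangleWave ξ :=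
  abs_nonneg _

namespace LagariasRodgers2020

/-- **Lagarias–Rodgers' class `𝒦_n`** (LR 2020, §2.4, Theorem 2.4): "band-limited test functions
`η ∈ 𝒮(ℝⁿ)` whose Fourier transform has support
`supp η̂ ⊂ {ξ ∈ ℝⁿ : ξ_1 + ⋯ + ξ_n ≠ 0 or |ξ_1| + ⋯ + |ξ_n| < 2}`" (band-limited = "has a compactly
supported Fourier transform", footnote). `ℝⁿ = EuclideanSpace ℝ (Fin n)`, `η̂ = 𝓕 η` (Mathlib),
`supp` = topological support. [cite: LagariasRodgers2020, §2.4 (class K_n)] -/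
def IsTestClassK (n : ℕ) (η : SchwartzMap (EuclideanSpace ℝ (Fin n)) ℂ) : Prop :=
  HasCompactSupport (𝓕 (⇑η)) ∧
    tsupport (𝓕 (⇑η)) ⊆ {ξ | ∑ i, ξ i ≠ 0 ∨ ∑ i, |ξ i| < 2}

/-- The `[T, 2T]`-averaged linear statistic `(1/T) ∫_T^{2T} ∑_{j∈ℤ} φ(c_j − t) dt` of a sequence
`c : ℤ → ℝ` (LR 2020, Theorems 2.3 and 3.1, left-hand sides). [cite: LagariasRodgers2020, Thm 3.1] -/
def averagedDensity (c : ℤ → ℝ) (φ : ℝ → ℂ) (T : ℝ) : ℂ :=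
  (T : ℂ)⁻¹ * ∫ t in T..2 * T, ∑' j : ℤ, φ (c j - t)

/-- The `[T, 2T]`-averaged `n`-correlation
`(1/T) ∫_T^{2T} ∑_{j_1,…,j_n ∈ ℤ distinct} η(c_{j_1} − t, …, c_{j_n} − t) dt` of a sequence
`c : ℤ → ℝ` against `η : ℝⁿ → ℂ` (LR 2020, Theorems 2.4 and 3.1, left-hand sides; ordered tuples of
distinct indices = embeddings `Fin n ↪ ℤ`). [cite: LagariasRodgers2020, Thm 3.1] -/
def averagedCorrelation (n : ℕ) (c : ℤ → ℝ) (η : EuclideanSpace ℝ (Fin n) → ℂ) (T : ℝ) : ℂ :=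
  (T : ℂ)⁻¹ * ∫ t in T..2 * T, ∑' j : Fin n ↪ ℤ, η (WithLp.toLp 2 fun i ↦ c (j i) - t)

/-- The sine-determinant integral `∫_{ℝⁿ} η(x) det_{1≤i,j≤n}[S(x_i − x_j)] dⁿx`, `S(x) = sin πx/(πx)`
(`sineKernel`; the determinant is the tree's `sineDeterminant`) — the GUE `n`-level right-hand side
of LR 2020, (2.1) (GUE Hypothesis) / Theorems 2.4, 3.1. [cite: LagariasRodgers2020, Thm 3.1] -/
def sineDeterminantIntegral (n : ℕ) (η : EuclideanSpace ℝ (Fin n) → ℂ) : ℂ :=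
  ∫ x : EuclideanSpace ℝ (Fin n), η x * (sineDeterminant (fun i ↦ x i) : ℂ)

end LagariasRodgers2020

/-- **Lagarias–Rodgers 2020, Theorem 3.1** (Q. J. Math. 71, published): "There exists a
(deterministic) sequence of points `{c_j}_{j∈ℤ}` on the real line such that
`c_{j+1} − c_j ∈ {½, 1, 3/2, 2, …}` for all `j`, and moreover for any `φ ∈ 𝒮(ℝ)`,
`lim_{T→∞} (1/T) ∫_T^{2T} ∑_{j∈ℤ} φ(c_j − t) dt = ∫_ℝ φ(x) dx`, and for each `n ≥ 2` and any
`η(x) ∈ 𝒦_n`,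
`lim_{T→∞} (1/T) ∫_T^{2T} ∑_{j_1,…,j_n distinct} η(c_{j_1} − t, …, c_{j_n} − t) dt
 = ∫_{ℝⁿ} η(x) det_{1≤i,j≤n}[S(x_i − x_j)] dⁿx`." That is: all information in the
Montgomery–Hejhal–Rudnick–Sarnak band-limited correlation theorem (LR Thm 2.4 = the tree's
`rudnick_sarnak`) is consistent with gaps lying in `½ℕ⁺` — the Alternative Hypothesis "cannot be
ruled out" by it. NAMED FACT (an unconditional published theorem; proof = the AH point process,
LR §§4–7, not in the tree). Users take `(h : lagariasRodgers2020_theorem31)`.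
[cite: LagariasRodgers2020, Thm 3.1] -/
def lagariasRodgers2020_theorem31 : Prop :=
  ∃ c : ℤ → ℝ,
    (∀ j : ℤ, ∃ k : ℕ, 1 ≤ k ∧ c (j + 1) - c j = (k : ℝ) / 2) ∧
    (∀ φ : SchwartzMap ℝ ℂ,
      Tendsto (LagariasRodgers2020.averagedDensity c φ) atTop (𝓝 (∫ x : ℝ, φ x))) ∧
    (∀ n : ℕ, 2 ≤ n → ∀ η : SchwartzMap (EuclideanSpace ℝ (Fin n)) ℂ,
      LagariasRodgers2020.IsTestClassK n η →
        Tendsto (LagariasRodgers2020.averagedCorrelation n c η) atTop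
          (𝓝 (LagariasRodgers2020.sineDeterminantIntegral n η)))

/-! ## §5. Proved glue (appended 2026-08-26, discharge layer: no new facts)

The purely logical implications announced by BGSTB 2025 — Corollary 1 "follows immediately from
Theorem 1 … by taking limits", Corollaries 2 and 3 are Corollary 1 at `p_0 = 1` and
`p_0 = 3/2 − 2/π²`, and Strong AH-Pairs is "a stronger form of AH-Pairs" — proved against the typed
statements (limit algebra only; RH and the AH predicates are threaded through untouched). -/

/-- **Strong AH-Pairs at a level `𝓜 > 0` implies AH-Pairs at every level `M`** (BGSTB 2025, §1:
"the required stronger form of AH-Pairs"): `R(T) log T → 0` forces `R(T) → 0`, and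
`𝒫(T, M) ⊆ 𝒬(T, 𝓜)` as soon as `2πM/log T ≤ 𝓜`. [cite: BaluyotGoldstonSuriajayaTurnageButterbaugh2025, §1 (Strong AH-Pairs)] -/
theorem StrongAHPairsAt.ahPairsAt {𝓜 : ℝ} (h𝓜 : 0 < 𝓜) (h : StrongAHPairsAt 𝓜) (M : ℝ) :
    AHPairsAt M := by
  obtain ⟨R, hR0, hRa, hRt, C, hC⟩ := h
  refine ⟨R, hR0, hRa, ?_, C, ?_⟩
  · have h1 : ∀ᶠ T : ℝ in atTop, 1 ≤ Real.log T := Real.tendsto_log_atTop.eventually_ge_atTop 1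
    refine squeeze_zero' (Eventually.of_forall fun T ↦ (hR0 T).le) ?_ hRt
    filter_upwards [h1] with T hT
    calc R T = R T * 1 := (mul_one _).symm
      _ ≤ R T * Real.log T := mul_le_mul_of_nonneg_left hT (hR0 T).le
  · have h1 : ∀ᶠ T : ℝ in atTop, 2 * π * M / 𝓜 ≤ Real.log T :=
      Real.tendsto_log_atTop.eventually_ge_atTop _
    have h2 : ∀ᶠ T : ℝ in atTop, 0 < Real.log T := Real.tendsto_log_atTop.eventually_gt_atTop 0
    filter_upwards [hC, h1, h2] with T hT hlog hlogpos p hp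
    apply hT p
    rw [AH.mem_pairs] at hp
    rw [AH.mem_nearPairs]
    refine ⟨hp.1, hp.2.1, hp.2.2.1, ?_⟩
    have hx : |AH.pairSpacing T p| ≤ M := hp.2.2.2
    have hid : zetaOrdinate p.1 - zetaOrdinate p.2 =
        AH.pairSpacing T p * (2 * π / Real.log T) := by
      unfold AH.pairSpacing
      field_simp
    rw [hid, abs_mul, abs_of_pos (by positivity : 0 < 2 * π / Real.log T)]
    have h2πM : 2 * π * M ≤ 𝓜 * Real.log T := (div_le_iff₀' h𝓜).mp hlog
    calc |AH.pairSpacing T p| * (2 * π / Real.log T)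
        ≤ M * (2 * π / Real.log T) := by gcongr
      _ = 2 * π * M / Real.log T := by ring
      _ ≤ 𝓜 := by rw [div_le_iff₀ hlogpos]; exact h2πM

/-- **Strong AH-Pairs implies AH-Pairs.** [cite: BaluyotGoldstonSuriajayaTurnageButterbaugh2025, §1 (Strong AH-Pairs)] -/
theorem StrongAHPairs.ahPairs (h : StrongAHPairs) : AHPairs :=
  fun M _ ↦ (h 1 one_pos).ahPairsAt one_pos M

/-- **Corollary 1 from Theorem 1** ("This corollary follows immediately from Theorem 1 since the
bounds on `p_0` follow from (thm1a), and by taking limits in (thm1b) the existence of `p_0` implies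
the existence of each `p_{k/2}`", BGSTB 2025, §2). [claim: BaluyotGoldstonSuriajayaTurnageButterbaugh2025, status: under-review] -/
theorem bgstb2025_corollary1_of_theorem1 (h : bgstb2025_theorem1) : bgstb2025_corollary1 := by
  intro hRH hAH δ hδ hδ' p₀ hp₀
  obtain ⟨ha, hb, hc⟩ := h hRH hAH δ hδ hδ'
  have hP0 : ∀ᶠ M : ℝ in atTop, Tendsto (fun T : ℝ ↦ AH.binDensity 0 T M δ) atTop (𝓝 p₀) := hp₀
  refine ⟨⟨?_, ?_⟩, fun k ↦ ?_⟩
  · refine le_of_forall_pos_le_add fun ε hε ↦ ?_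
    obtain ⟨M, hM1, hM2⟩ := ((ha ε hε).and hP0).exists
    have : 1 - ε ≤ p₀ := ge_of_tendsto hM2 (hM1.mono fun T hT ↦ hT.1)
    linarith
  · refine le_of_forall_pos_le_add fun ε hε ↦ ?_
    obtain ⟨M, hM1, hM2⟩ := ((ha ε hε).and hP0).exists
    exact le_of_tendsto hM2 (hM1.mono fun T hT ↦ hT.2)
  · rcases eq_or_ne k 0 with rfl | hk
    · simpa using hp₀
    rcases Int.even_or_odd k with he | ho
    · rw [AH.densityTable_of_even hk he]
      filter_upwards [hb k hk he, hP0] with M hM hM0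
      have := hM0.sub hM
      refine this.congr fun T ↦ ?_
      ring
    · rw [AH.densityTable_of_odd ho]
      filter_upwards [hc k ho, hP0] with M hM hM0
      have := hM.sub hM0
      refine (this.congr fun T ↦ ?_).trans ?_
      · ring
      · simp

/-- **Corollary 1, last sentence, from Theorem 1**: the existence of one `p_{k/2}` implies the
existence of `p_0` (by the same limit algebra). [claim: BaluyotGoldstonSuriajayaTurnageButterbaugh2025, status: under-review] -/
theorem bgstb2025_corollary1_of_one_of_theorem1 (h : bgstb2025_theorem1) :
    bgstb2025_corollary1_of_one := by
  intro hRH hAH δ hδ hδ' k p hp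
  obtain ⟨-, hb, hc⟩ := h hRH hAH δ hδ hδ'
  have hPk : ∀ᶠ M : ℝ in atTop, Tendsto (fun T : ℝ ↦ AH.binDensity k T M δ) atTop (𝓝 p) := hp
  rcases eq_or_ne k 0 with rfl | hk
  · exact ⟨p, hp⟩
  rcases Int.even_or_odd k with he | ho
  · refine ⟨p + 1 / 2, ?_⟩
    filter_upwards [hb k hk he, hPk] with M hM hMk
    exact (hMk.add hM).congr fun T ↦ by ring
  · refine ⟨3 / 2 - 2 / (π ^ 2 * (k : ℝ) ^ 2) - p, ?_⟩
    filter_upwards [hc k ho, hPk] with M hM hMk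
    exact (hM.sub hMk).congr fun T ↦ by ring

/-- **Corollary 2 from Corollary 1** (`p_0 = 1`). [claim: BaluyotGoldstonSuriajayaTurnageButterbaugh2025, status: under-review] -/
theorem bgstb2025_corollary2_of_corollary1 (h : bgstb2025_corollary1) : bgstb2025_corollary2 := by
  intro hRH hAH δ hδ hδ' h1 k
  obtain ⟨-, hall⟩ := h hRH hAH δ hδ hδ' 1 h1
  have hk := hall k
  rcases eq_or_ne k 0 with rfl | hk0
  · simpa using hk
  rcases Int.even_or_odd k with he | ho
  · rw [AH.densityTable_of_even hk0 he] at hk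
    rw [if_neg hk0, if_pos he]
    have e : (1 - 1 / 2 : ℝ) = 1 / 2 := by norm_num
    rw [e] at hk
    exact hk
  · rw [AH.densityTable_of_odd ho] at hk
    rw [if_neg hk0, if_neg (Int.not_even_iff_odd.mpr ho)]
    have e : (3 / 2 - 2 / (π ^ 2 * (k : ℝ) ^ 2) - 1 : ℝ) = 1 / 2 - 2 / (π ^ 2 * (k : ℝ) ^ 2) := by
      ring
    rw [e] at hk
    exact hk

/-- **Corollary 3 from Corollary 1** (`p_0 = 3/2 − 2/π²`; note `p_{1/2} = 0`). [claim: BaluyotGoldstonSuriajayaTurnageButterbaugh2025, status: under-review] -/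
theorem bgstb2025_corollary3_of_corollary1 (h : bgstb2025_corollary1) : bgstb2025_corollary3 := by
  intro hRH hAH δ hδ hδ' h1 k
  obtain ⟨-, hall⟩ := h hRH hAH δ hδ hδ' (3 / 2 - 2 / π ^ 2) h1
  have hk := hall k
  rcases eq_or_ne k 0 with rfl | hk0
  · simpa using hk
  rcases Int.even_or_odd k with he | ho
  · rw [AH.densityTable_of_even hk0 he] at hk
    rw [if_neg hk0, if_pos he]
    have e : (3 / 2 - 2 / π ^ 2 - 1 / 2 : ℝ) = 1 - 2 / π ^ 2 := by ring
    rw [e] at hk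
    exact hk
  · rw [AH.densityTable_of_odd ho] at hk
    rw [if_neg hk0, if_neg (Int.not_even_iff_odd.mpr ho)]
    have e : (3 / 2 - 2 / (π ^ 2 * (k : ℝ) ^ 2) - (3 / 2 - 2 / π ^ 2) : ℝ) =
        2 / π ^ 2 * (1 - 1 / (k : ℝ) ^ 2) := by
      ring
    rw [e] at hk
    exact hk

/-- Corollaries 2 and 3 from Theorem 1 (composition). [claim: BaluyotGoldstonSuriajayaTurnageButterbaugh2025, status: under-review] -/
theorem bgstb2025_corollary2_of_theorem1 (h : bgstb2025_theorem1) : bgstb2025_corollary2 :=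
  bgstb2025_corollary2_of_corollary1 (bgstb2025_corollary1_of_theorem1 h)

/-- Corollary 3 from Theorem 1 (composition). [claim: BaluyotGoldstonSuriajayaTurnageButterbaugh2025, status: under-review] -/
theorem bgstb2025_corollary3_of_theorem1 (h : bgstb2025_theorem1) : bgstb2025_corollary3 :=
  bgstb2025_corollary3_of_corollary1 (bgstb2025_corollary1_of_theorem1 h)

/-! ## §6. Appended 2026-08-26: the first display of (MT-Pairs), proved without RH

BGSTB 2025, §2, (MT-Pairs): "Assuming the Riemann Hypothesis, we have
`∑_{0<γ,γ'≤T} ĝ(((γ−γ')/2π) log T) w(γ−γ') = ((T/2π) log T) ∫ F(α) g(α) dα`." This first display is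
Fubini for a finite sum and holds unconditionally (`AH.sum_fourier_pairSpacing_eq_integral`); only
the second display (the typed claim `bgstb2025_mtPairs`) needs (MT), hence RH. -/

namespace AH


/-- A sum over the pairs `(γ, γ')`, `0 < γ, γ' ≤ T`, is unchanged by the swap `(γ, γ') ↦ (γ', γ)`
("since `w` is even", BGSTB 2025, §3, proof of (MT-Pairs)). [cite: BaluyotGoldstonSuriajayaTurnageButterbaugh2025, §3 (proof of MT-Pairs)] -/
theorem sum_pairs_swap {M : Type*} [AddCommMonoid M] (T : ℝ) (f : ℕ × ℕ → M) :
    ∑ p ∈ zeroIndexSet T ×ˢ zeroIndexSet T, f p =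
      ∑ p ∈ zeroIndexSet T ×ˢ zeroIndexSet T, f p.swap := by
  rw [Finset.sum_product, Finset.sum_product, Finset.sum_comm]
  rfl

/-- A term of `∑ e(−v·x_p) w(γ−γ')` plus its swapped partner is `2 cos(v log T (γ−γ')) w(γ−γ')`
(`x` is odd and `w` even under the swap). [cite: BaluyotGoldstonSuriajayaTurnageButterbaugh2025, §3 (proof of MT-Pairs)] -/
theorem exp_pairSpacing_add_swap (v T : ℝ) (p : ℕ × ℕ) :
    Complex.exp (↑(-2 * π * v * pairSpacing T p) * Complex.I) *
        (montgomeryWeight (zetaOrdinate p.1 - zetaOrdinate p.2) : ℂ) +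
      Complex.exp (↑(-2 * π * v * pairSpacing T p.swap) * Complex.I) *
        (montgomeryWeight (zetaOrdinate p.swap.1 - zetaOrdinate p.swap.2) : ℂ) =
    2 * ((Real.cos (v * Real.log T * (zetaOrdinate p.1 - zetaOrdinate p.2)) *
        montgomeryWeight (zetaOrdinate p.1 - zetaOrdinate p.2) : ℝ) : ℂ) := by
  have hw : montgomeryWeight (zetaOrdinate p.swap.1 - zetaOrdinate p.swap.2) =
      montgomeryWeight (zetaOrdinate p.1 - zetaOrdinate p.2) := by
    simp only [Prod.fst_swap, Prod.snd_swap, montgomeryWeight]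
    ring
  rw [hw, pairSpacing_swap]
  have hθ : -2 * π * v * pairSpacing T p =
      -(v * Real.log T * (zetaOrdinate p.1 - zetaOrdinate p.2)) := by
    unfold pairSpacing
    field_simp
  have hθ' : -2 * π * v * -pairSpacing T p =
      v * Real.log T * (zetaOrdinate p.1 - zetaOrdinate p.2) := by
    rw [mul_neg, hθ, neg_neg]
  rw [hθ, hθ', ← add_mul]
  push_cast
  rw [Complex.cos]
  ring

/-- `∑_{0<γ,γ'≤T} e(−v ((γ−γ')/2π) log T) w(γ−γ') = ∑_{0<γ,γ'≤T} cos(v log T (γ−γ')) w(γ−γ')`: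
the pair sum of the Fourier character is real ("since `w` is even", BGSTB 2025, §3, proof of
(MT-Pairs)). [cite: BaluyotGoldstonSuriajayaTurnageButterbaugh2025, §3 (proof of MT-Pairs)] -/
theorem sum_exp_pairSpacing_eq_sum_cos (v T : ℝ) :
    ∑ p ∈ zeroIndexSet T ×ˢ zeroIndexSet T,
        Complex.exp (↑(-2 * π * v * pairSpacing T p) * Complex.I) *
          (montgomeryWeight (zetaOrdinate p.1 - zetaOrdinate p.2) : ℂ) =
      ∑ p ∈ zeroIndexSet T ×ˢ zeroIndexSet T,
        ((Real.cos (v * Real.log T * (zetaOrdinate p.1 - zetaOrdinate p.2)) *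
          montgomeryWeight (zetaOrdinate p.1 - zetaOrdinate p.2) : ℝ) : ℂ) := by
  set f : ℕ × ℕ → ℂ := fun p ↦ Complex.exp (↑(-2 * π * v * pairSpacing T p) * Complex.I) *
    (montgomeryWeight (zetaOrdinate p.1 - zetaOrdinate p.2) : ℂ) with hf
  set g : ℕ × ℕ → ℂ := fun p ↦ ((Real.cos (v * Real.log T * (zetaOrdinate p.1 - zetaOrdinate p.2)) *
    montgomeryWeight (zetaOrdinate p.1 - zetaOrdinate p.2) : ℝ) : ℂ) with hg
  have key : ∀ p : ℕ × ℕ, f p + f p.swap = 2 * g p := fun p ↦ by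
    simp only [hf, hg]
    exact exp_pairSpacing_add_swap v T p
  have h2 : 2 * ∑ p ∈ zeroIndexSet T ×ˢ zeroIndexSet T, f p =
      2 * ∑ p ∈ zeroIndexSet T ×ˢ zeroIndexSet T, g p := by
    rw [two_mul, Finset.mul_sum]
    nth_rewrite 2 [sum_pairs_swap T f]
    rw [← Finset.sum_add_distrib]
    exact Finset.sum_congr rfl fun p _ ↦ key p
  exact mul_left_cancel₀ two_ne_zero h2

/-- `∑_{0<γ,γ'≤T} cos(v log T (γ−γ')) w(γ−γ') = (T log T/(2π)) F(v, T)` for `T > 1` (the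
normalisation of `montgomeryFormFactor`). [cite: BaluyotGoldstonSuriajayaTurnageButterbaugh2025, §1 (F(α))] -/
theorem sum_cos_eq_formFactor {T : ℝ} (hT : 1 < T) (v : ℝ) :
    ∑ p ∈ zeroIndexSet T ×ˢ zeroIndexSet T,
        Real.cos (v * Real.log T * (zetaOrdinate p.1 - zetaOrdinate p.2)) *
          montgomeryWeight (zetaOrdinate p.1 - zetaOrdinate p.2) =
      T * Real.log T / (2 * π) * montgomeryFormFactor v T := by
  have hlog : 0 < Real.log T := Real.log_pos hT
  have hT0 : 0 < T := by linarith
  unfold montgomeryFormFactor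
  field_simp

/-- **BGSTB 2025, (MT-Pairs), first display (Sumpair) — PROVED, and without RH**: for
`g ∈ L¹(ℝ)` and `T > 1`,
`∑_{0<γ,γ'≤T} ĝ(((γ − γ')/2π) log T) w(γ − γ') = ((T/2π) log T) ∫ F(α) g(α) dα`
(`ĝ = 𝓕 g`, Mathlib's Fourier transform of `g` cast to `ℂ`; `F = montgomeryFormFactor`,
`w = montgomeryWeight`). The source lists it under "Assuming the Riemann Hypothesis", but the proof
(§3: "Multiplying both sides … by `w(γ − γ')` and summing over `0 < γ, γ' ≤ T`") is the exchange of a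
finite sum with the integral plus the evenness of `w`; RH enters only the second display
(`bgstb2025_mtPairs`) through (MT). [cite: BaluyotGoldstonSuriajayaTurnageButterbaugh2025, §2 (MT-Pairs, first display)] -/
theorem sum_fourier_pairSpacing_eq_integral (g : ℝ → ℝ) (hg : Integrable g) {T : ℝ} (hT : 1 < T) :
    ∑ p ∈ zeroIndexSet T ×ˢ zeroIndexSet T,
        𝓕 (fun a : ℝ ↦ (g a : ℂ)) (pairSpacing T p) *
          (montgomeryWeight (zetaOrdinate p.1 - zetaOrdinate p.2) : ℂ) =
      ((T / (2 * π) * Real.log T * ∫ a : ℝ, montgomeryFormFactor a T * g a : ℝ) : ℂ) := by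
  -- unfold the Fourier transform and pull the finite sum inside the integral
  have hF : ∀ p : ℕ × ℕ, 𝓕 (fun a : ℝ ↦ (g a : ℂ)) (pairSpacing T p) =
      ∫ a : ℝ, Complex.exp (↑(-2 * π * a * pairSpacing T p) * Complex.I) * (g a : ℂ) := by
    intro p
    rw [Real.fourier_real_eq_integral_exp_smul]
    rfl
  simp_rw [hF, ← integral_mul_const]
  have hint : ∀ p ∈ zeroIndexSet T ×ˢ zeroIndexSet T, Integrable (fun a : ℝ ↦
      Complex.exp (↑(-2 * π * a * pairSpacing T p) * Complex.I) * (g a : ℂ) *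
        (montgomeryWeight (zetaOrdinate p.1 - zetaOrdinate p.2) : ℂ)) := by
    intro p _
    refine Integrable.mul_const ?_ _
    have hgC : Integrable (fun a : ℝ ↦ (g a : ℂ)) := hg.ofReal
    refine hgC.bdd_mul (c := 1) ?_ (Eventually.of_forall fun a ↦ ?_)
    · exact (by fun_prop : Continuous fun a : ℝ ↦
        Complex.exp (↑(-2 * π * a * pairSpacing T p) * Complex.I)).aestronglyMeasurable
    · rw [Complex.norm_exp_ofReal_mul_I]
  rw [← integral_finsetSum _ hint]
  -- pointwise: the sum of exponentials is the cosine sum, i.e. `(T log T / 2π) F(a, T)`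
  have hpt : ∀ a : ℝ, ∑ p ∈ zeroIndexSet T ×ˢ zeroIndexSet T,
      Complex.exp (↑(-2 * π * a * pairSpacing T p) * Complex.I) * (g a : ℂ) *
        (montgomeryWeight (zetaOrdinate p.1 - zetaOrdinate p.2) : ℂ) =
      ((T * Real.log T / (2 * π) * montgomeryFormFactor a T * g a : ℝ) : ℂ) := by
    intro a
    have := sum_exp_pairSpacing_eq_sum_cos a T
    calc ∑ p ∈ zeroIndexSet T ×ˢ zeroIndexSet T,
          Complex.exp (↑(-2 * π * a * pairSpacing T p) * Complex.I) * (g a : ℂ) *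
            (montgomeryWeight (zetaOrdinate p.1 - zetaOrdinate p.2) : ℂ)
        = (g a : ℂ) * ∑ p ∈ zeroIndexSet T ×ˢ zeroIndexSet T,
            Complex.exp (↑(-2 * π * a * pairSpacing T p) * Complex.I) *
              (montgomeryWeight (zetaOrdinate p.1 - zetaOrdinate p.2) : ℂ) := by
          rw [Finset.mul_sum]
          exact Finset.sum_congr rfl fun p _ ↦ by ring
      _ = (g a : ℂ) * ((∑ p ∈ zeroIndexSet T ×ˢ zeroIndexSet T,
            Real.cos (a * Real.log T * (zetaOrdinate p.1 - zetaOrdinate p.2)) *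
              montgomeryWeight (zetaOrdinate p.1 - zetaOrdinate p.2) : ℝ) : ℂ) := by
          rw [this]; push_cast; rfl
      _ = ((T * Real.log T / (2 * π) * montgomeryFormFactor a T * g a : ℝ) : ℂ) := by
          rw [sum_cos_eq_formFactor hT a]; push_cast; ring
  simp_rw [hpt]
  rw [integral_complex_ofReal]
  congr 1
  rw [← integral_const_mul]
  exact integral_congr_ae (Eventually.of_forall fun a ↦ by simp only; ring)

end AH

end Literature.NumberTheory.LFunctions

end
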